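import Summits.BirchSwinnertonDyer.Rank1Residual.X5.TwoAdicInstancesToolkit
import HarnessLib

/-!
# X5 at `p = 2` (cell `bsd-2adic`, seat `bsd-2adic-ord`): toolkit, part B — minimality when
# `gcd(Δ, c₄) = ℓ²`, and good ORDINARY reduction at `2` with `#Ẽ(𝔽₂) = 2`

Two more bookkeeping lemmas for the class-closure files `X5/TwoAdicInstances<class>.lean` (HONEST
FRAMING as in `X5/TwoAdicInstancesToolkit.lean`; nothing asserted, 0 named facts):
* `int_criterion_of_gcd_eq_prime_sq` — Silverman's sufficient minimality criterion (AEC VII.1 Remark 1.1: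
  no prime `q` with `q¹² ∣ Δ` and `q⁴ ∣ c₄`) when `gcd(Δ, c₄) = ℓ²` and `ℓ⁴ ∤ c₄` (the CF classes with an
  additive prime `ℓ`, `ℓ² ∥ N`: 70473c, 144027d, 249501a/f, 309435p, 311211a, 358449e, 363951h, 439893f);
* `goodOrd_two_baseChange_int_of_card_two` — `2 ∤ Δ(W₀)` and `#W₀(𝔽₂) = 2` (`a₂ = +1`) ⇒ `GoodOrd (W₀ ⊗ ℚ) 2`
  (the twin of `goodOrd_two_baseChange_int`, which reads `#W₀(𝔽₂) = 4`, `a₂ = −1`).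

References: [SilvermanAEC2009] VII.1 Remark 1.1, VII.5 Prop. 5.1(a).
-/

set_option autoImplicit false

open WeierstrassCurve Literature.NumberTheory.EllipticCurves Literature.NumberTheory.EllipticCurves.Rank1Residual

namespace Summit.BirchSwinnertonDyer.Rank1Residual.X5.Instances

/-- **Silverman's criterion when `gcd(Δ, c₄) = ℓ²` and `ℓ⁴ ∤ c₄`**: a prime `q` with `q¹² ∣ Δ` and
`q⁴ ∣ c₄` would divide `gcd(Δ, c₄) = ℓ²`, so `q = ℓ`, contradicting `ℓ⁴ ∤ c₄`.
[cite: SilvermanAEC2009, VII.1 Remark 1.1] -/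
theorem int_criterion_of_gcd_eq_prime_sq {D C : ℤ} {ℓ : ℕ} (hℓ : ℓ.Prime) (hgcd : Int.gcd D C = ℓ ^ 2)
    (h4 : ¬ (ℓ : ℤ) ^ 4 ∣ C) (q : ℕ) (hq : q.Prime) : ¬ ((q : ℤ) ^ 12 ∣ D ∧ (q : ℤ) ^ 4 ∣ C) := by
  rintro ⟨h12, hq4⟩
  have hqD : (q : ℤ) ∣ D := (dvd_pow_self (q : ℤ) (by norm_num)).trans h12
  have hqC : (q : ℤ) ∣ C := (dvd_pow_self (q : ℤ) (by norm_num)).trans hq4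
  have hg : (q : ℤ) ∣ (Int.gcd D C : ℤ) := Int.dvd_coe_gcd hqD hqC
  rw [hgcd, Nat.cast_pow] at hg
  have hqℓ : q ∣ ℓ := by exact_mod_cast Int.Prime.dvd_pow' hq hg
  obtain rfl := (Nat.prime_dvd_prime_iff_eq hq hℓ).mp hqℓ
  exact h4 hq4

/-- **Good ORDINARY reduction at `2` with `#W₀(𝔽₂) = 2`** (`2 ∤ Δ(W₀)`; `a₂ = 3 − 2 = 1` is odd).
[cite: SilvermanAEC2009, VII.5 Prop. 5.1(a)] -/
theorem goodOrd_two_baseChange_int_of_card_two (W₀ : WeierstrassCurve ℤ) [(W₀.baseChange ℚ).IsGloballyMinimal]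
    [(W₀.baseChange ℚ).IsElliptic] (hΔ : ¬ (2 : ℤ) ∣ W₀.Δ)
    (hcard : Nat.card (W₀.map (Int.castRingHom (ZMod 2))).toAffine.Point = 2) :
    GoodOrd (W₀.baseChange ℚ) 2 := by
  refine ⟨hasGoodReductionAtPrime_of_not_dvd _ 2 (by rwa [minimalDiscriminantInt_baseChange_int]), ?_⟩
  rw [frobeniusTrace, reductionPointCount_baseChange_int, hcard]
  decide

end Summit.BirchSwinnertonDyer.Rank1Residual.X5.Instances
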